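import Summits.AtomisticToContinuum.BoseEinsteinCondensation.Theorems.BECInsertionCorrectorStaticResponseBoundModulationEulerLagrange
import HarnessLib

/-!
# Modulated minimisers on the torus, III: the two-point susceptibility inequality (support for
# stub S3 `ModulationBootstrap`, item stmt-AtomisticToContinuum-12057)

Part 3 of 5. For positive real minimisers `Φ` at coupling `s` and `Ψ` at `s''` of
`E_w + s⟨∑cos⟩`: the exact identity `(s''-s)(V̄_Φ - V̄_Ψ) = 𝓔_Φ(|Ψ|/|Φ|) + 𝓔_Ψ(|Φ|/|Ψ|)`
(`sub_mul_cosMean_sub_eq`), the Kipnis–Varadhan bound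
`|V̄_Φ - V̄_Ψ| ≤ 2√(K𝓔_Φ(|Ψ|/|Φ|)) + 2N∫(|Ψ|-|Φ|)²` from a susceptibility bound `≤ K` at `Φ`
(`abs_cosMean_sub_le`), `∫(|Ψ|-|Φ|)² ≤ 2C𝓔_Φ(|Ψ|/|Φ|)` from one Poincaré constant
(`integral_sub_sq_le_of_poincare`), and the sharp two-point inequality
`|V̄_Φ - V̄_Ψ|(1 - 4NC|s''-s|)² ≤ 2K|s''-s|` (`abs_cosMean_sub_mul_sq_le`) — the discrete form of
`E″(s) = -2χ_s ≥ -2K` (second-order perturbation theory done variationally).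

References: [Kato1966] VII §3; [KipnisVaradhan1986] (1.14).
-/

noncomputable section

namespace Summit.AtomisticToContinuum.BoseEinsteinCondensation.Cruxes.StaticResponseBound.UvThomsonForceWave

open MeasureTheory Filter Metric
open scoped ENNReal NNReal BigOperators Topology
open Literature.MathematicalPhysics.QuantumManyBody.BoseGas
open Summit.AtomisticToContinuum.BoseEinsteinCondensation.Theses.BECInsertionCorrector
open Summit.AtomisticToContinuum.BoseEinsteinCondensation.Theorems.StaticResponseBound.Negative

variable {N : ℕ} {L : ℝ}

/-! ### The two-point susceptibility inequality for a pair of minimisers -/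

section TwoPoint

variable {w : ℝ → ℝ≥0∞} {Φ Ψ : PeriodicTrialState N L}

/-- `|∑ⱼ cos(p·xⱼ)| ≤ N` pointwise. [folklore] -/
theorem abs_sum_cos_le (L : ℝ) (k : Fin 3 → ℤ) (X : Config N) :
    |∑ j, Real.cos (2 * Real.pi / L * ∑ i, (k i : ℝ) * X j i)| ≤ N := by
  calc |∑ j, Real.cos (2 * Real.pi / L * ∑ i, (k i : ℝ) * X j i)|
      ≤ ∑ j, |Real.cos (2 * Real.pi / L * ∑ i, (k i : ℝ) * X j i)| := Finset.abs_sum_le_sum_abs _ _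
    _ ≤ ∑ _j : Fin N, (1 : ℝ) := Finset.sum_le_sum fun j _ => Real.abs_cos_le_one _
    _ = N := by simp

/-- `Γ(φ - c, φ - c) = Γ(φ, φ)` for a constant `c`. [folklore] -/
theorem gradDot_sub_const (φ : Config N → ℝ) (c : ℝ) (X : Config N) :
    gradDot (fun Y => φ Y - c) (fun Y => φ Y - c) X = gradDot φ φ X := by
  simp only [gradDot, pderiv, fderiv_sub_const]

/-- **Exact second-order identity for a pair of minimisers.** If `Φ` minimises `E_w + s⟨∑cos⟩` and
`Ψ` minimises `E_w + s''⟨∑cos⟩` (both positive real, finite energy), then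
`(s'' - s)(⟨∑cos⟩_Φ - ⟨∑cos⟩_Ψ) = 𝓔_{|Φ|}(|Ψ|/|Φ|) + 𝓔_{|Ψ|}(|Φ|/|Ψ|) ≥ 0` — the ground-state
representation (b) applied both ways. In particular `s ↦ ⟨∑cos⟩_{Φ_s}` is non-increasing
(concavity of the ground-state energy in the coupling). [cite: Kato1966, VII §3] -/
theorem sub_mul_cosMean_sub_eq (hL : 0 < L) (hw : Measurable w) (k : Fin 3 → ℤ) {s s'' : ℝ}
    (hreal : ∀ X, Φ.ψ X = (‖Φ.ψ X‖ : ℂ)) (hpos : ∀ X, Φ.ψ X ≠ 0) (hfin : periodicEnergy w Φ ≠ ⊤)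
    (hmin : ∀ Ψ' : PeriodicTrialState N L, periodicEnergy w Ψ' ≠ ⊤ →
      (periodicEnergy w Φ).toReal + s * cosMean L k Φ ≤
        (periodicEnergy w Ψ').toReal + s * cosMean L k Ψ')
    (hrealΨ : ∀ X, Ψ.ψ X = (‖Ψ.ψ X‖ : ℂ)) (hposΨ : ∀ X, Ψ.ψ X ≠ 0) (hfinΨ : periodicEnergy w Ψ ≠ ⊤)
    (hminΨ : ∀ Ψ' : PeriodicTrialState N L, periodicEnergy w Ψ' ≠ ⊤ →
      (periodicEnergy w Ψ).toReal + s'' * cosMean L k Ψ ≤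
        (periodicEnergy w Ψ').toReal + s'' * cosMean L k Ψ') :
    (s'' - s) * (cosMean L k Φ - cosMean L k Ψ) =
      dirichletFormW L (fun X => ‖Φ.ψ X‖) (fun X => ‖Ψ.ψ X‖ / ‖Φ.ψ X‖)
          (fun X => ‖Ψ.ψ X‖ / ‖Φ.ψ X‖) +
        dirichletFormW L (fun X => ‖Ψ.ψ X‖) (fun X => ‖Φ.ψ X‖ / ‖Ψ.ψ X‖)
          (fun X => ‖Φ.ψ X‖ / ‖Ψ.ψ X‖) := by
  have h1 := (gsRepresentation_of_real hL hw hreal hpos hfin k s hmin Ψ hrealΨ).2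
  have h2 := (gsRepresentation_of_real hL hw hrealΨ hposΨ hfinΨ k s'' hminΨ Φ hreal).2
  linarith

/-- **First-order bound from the susceptibility.** Let `Φ` be positive real with centred static
susceptibility `‖∑cos - ⟨∑cos⟩_Φ‖²_{H₋₁(|Φ|²)} ≤ K`, and `Ψ` any real nonnegative periodic state.
Writing `|Ψ| = (1 + ζ)|Φ|` one has `⟨∑cos⟩_Φ - ⟨∑cos⟩_Ψ = -2∫gζ|Φ|² - ∫gζ²|Φ|²`
(`g = ∑cos - ⟨∑cos⟩_Φ`), whence by Kipnis–Varadhan's criterion and `|g| ≤ 2N`: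
`|⟨∑cos⟩_Φ - ⟨∑cos⟩_Ψ| ≤ 2 √(K 𝓔_{|Φ|}(|Ψ|/|Φ|)) + 2N ∫(|Ψ| - |Φ|)²`.
[cite: KipnisVaradhan1986, (1.14)] -/
theorem abs_cosMean_sub_le (k : Fin 3 → ℤ) {K : ℝ} (hK : 0 ≤ K)
    (hreal : ∀ X, Φ.ψ X = (‖Φ.ψ X‖ : ℂ)) (hpos : ∀ X, Φ.ψ X ≠ 0)
    (hχ : hMinusOneSqW L (fun X => ‖Φ.ψ X‖)
        (fun X => (∑ j, Real.cos (2 * Real.pi / L * ∑ i, (k i : ℝ) * X j i)) - cosMean L k Φ)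
      ≤ ENNReal.ofReal K)
    (hrealΨ : ∀ X, Ψ.ψ X = (‖Ψ.ψ X‖ : ℂ)) :
    |cosMean L k Φ - cosMean L k Ψ| ≤
      2 * Real.sqrt (K * dirichletFormW L (fun X => ‖Φ.ψ X‖) (fun X => ‖Ψ.ψ X‖ / ‖Φ.ψ X‖)
          (fun X => ‖Ψ.ψ X‖ / ‖Φ.ψ X‖)) +
        2 * N * ∫ X in cellN N L, (‖Ψ.ψ X‖ - ‖Φ.ψ X‖) ^ 2 := by
  set F : Config N → ℝ := fun X => ‖Φ.ψ X‖ with hFdef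
  set G : Config N → ℝ := fun X => ‖Ψ.ψ X‖ with hGdef
  set V : Config N → ℝ := fun X => ∑ j, Real.cos (2 * Real.pi / L * ∑ i, (k i : ℝ) * X j i)
    with hVdef
  set ζ : Config N → ℝ := fun X => G X / F X - 1 with hζdef
  have hF : ContDiff ℝ 1 F := contDiff_norm_of_real Φ hreal
  have hG : ContDiff ℝ 1 G := contDiff_norm_of_real Ψ hrealΨ
  have hF0 : ∀ X, F X ≠ 0 := fun X => norm_ne_zero_iff.2 (hpos X)
  have hVc : Continuous V := by simp only [hVdef]; fun_prop
  have hζc : ContDiff ℝ 1 ζ := (hG.div hF hF0).sub contDiff_const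
  have hζtest : IsPeriodicTest L ζ :=
    ⟨hζc, fun X i a => by simp only [hζdef, hGdef, hFdef, Ψ.periodic X i a, Φ.periodic X i a]⟩
  -- Kipnis–Varadhan at `Φ` with the test function `ζ`
  have hCS := (hMinusOneSqW_le_ofReal_iff hK).1 hχ ζ hζtest
  have hDir : dirichletFormW L F ζ ζ = dirichletFormW L F (fun X => G X / F X) fun X => G X / F X := by
    unfold dirichletFormW
    simp only [hζdef, gradDot_sub_const]
  rw [hDir] at hCS
  -- `|Ψ| = (1 + ζ)|Φ|`
  have hrepr : ∀ X, G X = (1 + 1 * ζ X) * F X := fun X => by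
    simp only [hζdef]
    rw [one_mul, add_sub_cancel, div_mul_cancel₀ _ (hF0 X)]
  -- expansions
  have iV0 : IntegrableOn (fun X => V X * F X ^ 2) (cellN N L) :=
    integrableOn_cellN (hVc.mul (hF.continuous.pow 2)) L
  have iV1 : IntegrableOn (fun X => V X * ζ X * F X ^ 2) (cellN N L) :=
    integrableOn_cellN ((hVc.mul hζc.continuous).mul (hF.continuous.pow 2)) L
  have iV2 : IntegrableOn (fun X => V X * ζ X ^ 2 * F X ^ 2) (cellN N L) :=
    integrableOn_cellN ((hVc.mul (hζc.continuous.pow 2)).mul (hF.continuous.pow 2)) L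
  have i10 : IntegrableOn (fun X => (1 : ℝ) * F X ^ 2) (cellN N L) :=
    integrableOn_cellN (continuous_const.mul (hF.continuous.pow 2)) L
  have i11 : IntegrableOn (fun X => (1 : ℝ) * ζ X * F X ^ 2) (cellN N L) :=
    integrableOn_cellN ((continuous_const.mul hζc.continuous).mul (hF.continuous.pow 2)) L
  have i12 : IntegrableOn (fun X => (1 : ℝ) * ζ X ^ 2 * F X ^ 2) (cellN N L) :=
    integrableOn_cellN ((continuous_const.mul (hζc.continuous.pow 2)).mul (hF.continuous.pow 2)) L
  have hcosΦ : cosMean L k Φ = ∫ X in cellN N L, V X * F X ^ 2 := rfl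
  have hcosΨ : cosMean L k Ψ = (∫ X in cellN N L, V X * F X ^ 2) +
      2 * 1 * (∫ X in cellN N L, V X * ζ X * F X ^ 2) +
        1 ^ 2 * ∫ X in cellN N L, V X * ζ X ^ 2 * F X ^ 2 := by
    rw [← integral_mul_perturb_sq 1 iV0 iV1 iV2]
    unfold cosMean
    congr 1 with X
    rw [← hrepr X]
  have hone' : ∫ X in cellN N L, (1 : ℝ) * ((1 + 1 * ζ X) * F X) ^ 2 = 1 := by
    calc ∫ X in cellN N L, (1 : ℝ) * ((1 + 1 * ζ X) * F X) ^ 2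
        = ∫ X in cellN N L, ‖Ψ.ψ X‖ ^ 2 := by congr 1 with X; rw [one_mul, ← hrepr X]
      _ = 1 := integral_norm_sq_eq_one Ψ
  have hone : (1 : ℝ) = (∫ X in cellN N L, (1 : ℝ) * F X ^ 2) +
      2 * 1 * (∫ X in cellN N L, (1 : ℝ) * ζ X * F X ^ 2) +
        1 ^ 2 * ∫ X in cellN N L, (1 : ℝ) * ζ X ^ 2 * F X ^ 2 := by
    rw [← integral_mul_perturb_sq 1 i10 i11 i12, hone']
  have hF1 : ∫ X in cellN N L, (1 : ℝ) * F X ^ 2 = 1 := by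
    simp only [one_mul]; exact integral_norm_sq_eq_one Φ
  -- the pairings with `g = V - ⟨V⟩_Φ`
  have hg1 : ∫ X in cellN N L, (V X - cosMean L k Φ) * ζ X * F X ^ 2 =
      (∫ X in cellN N L, V X * ζ X * F X ^ 2) -
        cosMean L k Φ * ∫ X in cellN N L, (1 : ℝ) * ζ X * F X ^ 2 := by
    rw [← integral_const_mul, ← integral_sub iV1 (i11.const_mul _)]
    congr 1 with X; ring
  have hg2 : ∫ X in cellN N L, (V X - cosMean L k Φ) * ζ X ^ 2 * F X ^ 2 =
      (∫ X in cellN N L, V X * ζ X ^ 2 * F X ^ 2) -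
        cosMean L k Φ * ∫ X in cellN N L, (1 : ℝ) * ζ X ^ 2 * F X ^ 2 := by
    rw [← integral_const_mul, ← integral_sub iV2 (i12.const_mul _)]
    congr 1 with X; ring
  -- `D = -2 ∫ g ζ F² - ∫ g ζ² F²`
  have hD : cosMean L k Φ - cosMean L k Ψ =
      -2 * (∫ X in cellN N L, (V X - cosMean L k Φ) * ζ X * F X ^ 2) -
        ∫ X in cellN N L, (V X - cosMean L k Φ) * ζ X ^ 2 * F X ^ 2 := by
    rw [hg1, hg2]
    rw [hF1] at hone
    have h0 : 2 * (∫ X in cellN N L, (1 : ℝ) * ζ X * F X ^ 2) +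
        ∫ X in cellN N L, (1 : ℝ) * ζ X ^ 2 * F X ^ 2 = 0 := by linarith
    linear_combination hcosΦ - hcosΨ - cosMean L k Φ * h0
  -- bounds on the two pairings
  have hx : |∫ X in cellN N L, (V X - cosMean L k Φ) * ζ X * F X ^ 2| ≤
      Real.sqrt (K * dirichletFormW L F (fun X => G X / F X) fun X => G X / F X) :=
    Real.abs_le_sqrt hCS
  have hy : |∫ X in cellN N L, (V X - cosMean L k Φ) * ζ X ^ 2 * F X ^ 2| ≤
      2 * N * ∫ X in cellN N L, (G X - F X) ^ 2 := by
    have hpt : ∀ X, |(V X - cosMean L k Φ) * ζ X ^ 2 * F X ^ 2| ≤ 2 * N * (G X - F X) ^ 2 := by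
      intro X
      have hζF : ζ X * F X = G X - F X := by
        simp only [hζdef]
        rw [sub_mul, div_mul_cancel₀ _ (hF0 X), one_mul]
      rw [abs_mul, abs_mul, abs_of_nonneg (sq_nonneg (ζ X)), abs_of_nonneg (sq_nonneg (F X)),
        mul_assoc, ← mul_pow, hζF]
      refine mul_le_mul_of_nonneg_right ?_ (sq_nonneg _)
      calc |V X - cosMean L k Φ| ≤ |V X| + |cosMean L k Φ| := abs_sub _ _
        _ ≤ N + N := add_le_add (abs_sum_cos_le L k X) (abs_cosMean_le k Φ)
        _ = 2 * N := by ring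
    have hint : IntegrableOn (fun X => 2 * N * (G X - F X) ^ 2) (cellN N L) :=
      integrableOn_cellN (continuous_const.mul ((hG.continuous.sub hF.continuous).pow 2)) L
    calc |∫ X in cellN N L, (V X - cosMean L k Φ) * ζ X ^ 2 * F X ^ 2|
        ≤ ∫ X in cellN N L, |(V X - cosMean L k Φ) * ζ X ^ 2 * F X ^ 2| :=
          abs_integral_le_integral_abs
      _ ≤ ∫ X in cellN N L, 2 * N * (G X - F X) ^ 2 :=
          integral_mono_of_nonneg (ae_of_all _ fun X => abs_nonneg _) hint (ae_of_all _ hpt)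
      _ = 2 * N * ∫ X in cellN N L, (G X - F X) ^ 2 := integral_const_mul _ _
  obtain ⟨hx1, hx2⟩ := abs_le.1 hx
  obtain ⟨hy1, hy2⟩ := abs_le.1 hy
  rw [hD, abs_le]
  constructor <;> linarith

/-- **The `L²` distance of two normalised states is controlled by ONE Poincaré constant.** If
`|Φ|² dX` satisfies the weighted Poincaré (variance) inequality with constant `C` on the periodic
`C¹` core, then for every real nonnegative periodic state `Ψ`:
`∫(|Ψ| - |Φ|)² ≤ 2C 𝓔_{|Φ|}(|Ψ|/|Φ|)` (`∫(|Ψ|-|Φ|)² = 2(1 - ∫|Ψ||Φ|) ≤ 2 Var_{|Φ|²}(|Ψ|/|Φ|)`).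
[folklore] -/
theorem integral_sub_sq_le_of_poincare {C : ℝ}
    (hreal : ∀ X, Φ.ψ X = (‖Φ.ψ X‖ : ℂ)) (hpos : ∀ X, Φ.ψ X ≠ 0)
    (hP : ∀ φ : Config N → ℝ, IsPeriodicTest L φ →
      (∫ X in cellN N L, φ X ^ 2 * ‖Φ.ψ X‖ ^ 2) - (∫ X in cellN N L, φ X * ‖Φ.ψ X‖ ^ 2) ^ 2 ≤
        C * dirichletFormW L (fun X => ‖Φ.ψ X‖) φ φ)
    (hrealΨ : ∀ X, Ψ.ψ X = (‖Ψ.ψ X‖ : ℂ)) :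
    ∫ X in cellN N L, (‖Ψ.ψ X‖ - ‖Φ.ψ X‖) ^ 2 ≤
      2 * C * dirichletFormW L (fun X => ‖Φ.ψ X‖) (fun X => ‖Ψ.ψ X‖ / ‖Φ.ψ X‖)
        (fun X => ‖Ψ.ψ X‖ / ‖Φ.ψ X‖) := by
  set F : Config N → ℝ := fun X => ‖Φ.ψ X‖ with hFdef
  set G : Config N → ℝ := fun X => ‖Ψ.ψ X‖ with hGdef
  have hF : ContDiff ℝ 1 F := contDiff_norm_of_real Φ hreal
  have hG : ContDiff ℝ 1 G := contDiff_norm_of_real Ψ hrealΨ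
  have hF0 : ∀ X, F X ≠ 0 := fun X => norm_ne_zero_iff.2 (hpos X)
  have hη : IsPeriodicTest L fun X => G X / F X :=
    ⟨hG.div hF hF0, fun X i a => by simp only [hGdef, hFdef, Ψ.periodic X i a, Φ.periodic X i a]⟩
  have hPη := hP _ hη
  have e1 : ∫ X in cellN N L, (G X / F X) ^ 2 * ‖Φ.ψ X‖ ^ 2 = 1 := by
    rw [← integral_norm_sq_eq_one Ψ]
    congr 1 with X
    show (G X / F X) ^ 2 * F X ^ 2 = G X ^ 2
    rw [div_pow, div_mul_cancel₀ _ (pow_ne_zero 2 (hF0 X))]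
  set m : ℝ := ∫ X in cellN N L, G X * F X with hm
  have e2 : ∫ X in cellN N L, G X / F X * ‖Φ.ψ X‖ ^ 2 = m := by
    rw [hm]
    congr 1 with X
    show G X / F X * F X ^ 2 = G X * F X
    rw [sq, ← mul_assoc, div_mul_cancel₀ _ (hF0 X)]
  rw [e1, e2] at hPη
  have hm0 : 0 ≤ m := integral_nonneg fun X => mul_nonneg (norm_nonneg _) (norm_nonneg _)
  -- `ρ² = 2 - 2m`
  have iGG : IntegrableOn (fun X => G X ^ 2) (cellN N L) :=
    integrableOn_cellN ((hG.continuous).pow 2) L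
  have iGF : IntegrableOn (fun X => G X * F X) (cellN N L) :=
    integrableOn_cellN (hG.continuous.mul hF.continuous) L
  have iFF : IntegrableOn (fun X => F X ^ 2) (cellN N L) :=
    integrableOn_cellN ((hF.continuous).pow 2) L
  have hρ : ∫ X in cellN N L, (G X - F X) ^ 2 = 2 - 2 * m := by
    have hpt : ∀ X, (G X - F X) ^ 2 = G X ^ 2 - 2 * (G X * F X) + F X ^ 2 := fun X => by ring
    simp_rw [hpt]
    have hA : Integrable (fun X => G X ^ 2 - 2 * (G X * F X)) (volume.restrict (cellN N L)) :=
      iGG.sub (iGF.const_mul _)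
    rw [integral_add hA iFF, integral_sub iGG (iGF.const_mul _), integral_const_mul,
      integral_norm_sq_eq_one Ψ, integral_norm_sq_eq_one Φ, ← hm]
    ring
  have hρ0 : 0 ≤ ∫ X in cellN N L, (G X - F X) ^ 2 := integral_nonneg fun X => sq_nonneg _
  rw [hρ] at hρ0 ⊢
  nlinarith

/-- **The two-point susceptibility inequality.** Let `Φ`, `Ψ` be positive real finite-energy
minimisers of `E_w + s⟨∑cos⟩` and `E_w + s''⟨∑cos⟩` respectively, both with centred static
susceptibility `≤ K`, and let `|Φ|² dX` have Poincaré (variance) constant `C` on the periodic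
`C¹` core. If `4NC|s'' - s| < 1` then
`|⟨∑cos⟩_Φ - ⟨∑cos⟩_Ψ| (1 - 4NC|s'' - s|)² ≤ 2K|s'' - s|`
— the discrete form of `|dV̄/ds| = |E″(s)| = 2χ_s ≤ 2K` with the SHARP constant (harmonic mean
of the two Cauchy–Schwarz bounds against the exact identity
`(s''-s)(V̄_Φ - V̄_Ψ) = 𝓔_Φ(|Ψ|/|Φ|) + 𝓔_Ψ(|Φ|/|Ψ|)`). At `s'' = s` it says that all positive
minimisers at one coupling have the same `⟨∑cos⟩` (discrete second-order perturbation theory of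
an isolated eigenvalue). [cite: Kato1966, VII §3] -/
theorem abs_cosMean_sub_mul_sq_le (hL : 0 < L) (hw : Measurable w) (k : Fin 3 → ℤ)
    {s s'' K C : ℝ} (hK : 0 ≤ K) (hC : 0 ≤ C)
    (hreal : ∀ X, Φ.ψ X = (‖Φ.ψ X‖ : ℂ)) (hpos : ∀ X, Φ.ψ X ≠ 0) (hfin : periodicEnergy w Φ ≠ ⊤)
    (hmin : ∀ Ψ' : PeriodicTrialState N L, periodicEnergy w Ψ' ≠ ⊤ →
      (periodicEnergy w Φ).toReal + s * cosMean L k Φ ≤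
        (periodicEnergy w Ψ').toReal + s * cosMean L k Ψ')
    (hχ : hMinusOneSqW L (fun X => ‖Φ.ψ X‖)
        (fun X => (∑ j, Real.cos (2 * Real.pi / L * ∑ i, (k i : ℝ) * X j i)) - cosMean L k Φ)
      ≤ ENNReal.ofReal K)
    (hP : ∀ φ : Config N → ℝ, IsPeriodicTest L φ →
      (∫ X in cellN N L, φ X ^ 2 * ‖Φ.ψ X‖ ^ 2) - (∫ X in cellN N L, φ X * ‖Φ.ψ X‖ ^ 2) ^ 2 ≤
        C * dirichletFormW L (fun X => ‖Φ.ψ X‖) φ φ)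
    (hrealΨ : ∀ X, Ψ.ψ X = (‖Ψ.ψ X‖ : ℂ)) (hposΨ : ∀ X, Ψ.ψ X ≠ 0) (hfinΨ : periodicEnergy w Ψ ≠ ⊤)
    (hminΨ : ∀ Ψ' : PeriodicTrialState N L, periodicEnergy w Ψ' ≠ ⊤ →
      (periodicEnergy w Ψ).toReal + s'' * cosMean L k Ψ ≤
        (periodicEnergy w Ψ').toReal + s'' * cosMean L k Ψ')
    (hχΨ : hMinusOneSqW L (fun X => ‖Ψ.ψ X‖)
        (fun X => (∑ j, Real.cos (2 * Real.pi / L * ∑ i, (k i : ℝ) * X j i)) - cosMean L k Ψ)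
      ≤ ENNReal.ofReal K)
    (hδ : 4 * N * C * |s'' - s| < 1) :
    |cosMean L k Φ - cosMean L k Ψ| * (1 - 4 * N * C * |s'' - s|) ^ 2 ≤ 2 * K * |s'' - s| := by
  set a := dirichletFormW L (fun X => ‖Φ.ψ X‖) (fun X => ‖Ψ.ψ X‖ / ‖Φ.ψ X‖)
    (fun X => ‖Ψ.ψ X‖ / ‖Φ.ψ X‖) with ha
  set b := dirichletFormW L (fun X => ‖Ψ.ψ X‖) (fun X => ‖Φ.ψ X‖ / ‖Ψ.ψ X‖)
    (fun X => ‖Φ.ψ X‖ / ‖Ψ.ψ X‖) with hb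
  set D := cosMean L k Φ - cosMean L k Ψ with hDdef
  set ρ := ∫ X in cellN N L, (‖Ψ.ψ X‖ - ‖Φ.ψ X‖) ^ 2 with hρdef
  have ha0 : 0 ≤ a := dirichletFormW_self_nonneg L _ _
  have hb0 : 0 ≤ b := dirichletFormW_self_nonneg L _ _
  have hab : (s'' - s) * D = a + b :=
    sub_mul_cosMean_sub_eq hL hw k hreal hpos hfin hmin hrealΨ hposΨ hfinΨ hminΨ
  have h1 : |D| ≤ 2 * Real.sqrt (K * a) + 2 * N * ρ := abs_cosMean_sub_le k hK hreal hpos hχ hrealΨ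
  have h2 : |D| ≤ 2 * Real.sqrt (K * b) + 2 * N * ρ := by
    have h := abs_cosMean_sub_le k hK hrealΨ hposΨ hχΨ hreal
    have hρ' : ∫ X in cellN N L, (‖Φ.ψ X‖ - ‖Ψ.ψ X‖) ^ 2 = ρ := by
      rw [hρdef]; congr 1 with X; ring
    rwa [abs_sub_comm, hρ'] at h
  have hρa : ρ ≤ 2 * C * a := integral_sub_sq_le_of_poincare hreal hpos hP hrealΨ
  have hN : (0 : ℝ) ≤ N := Nat.cast_nonneg N
  -- `δ |D| = a + b`, `R := 2Nρ ≤ 4NC δ |D|`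
  have habs : |s'' - s| * |D| = a + b := by
    rw [← abs_mul, hab, abs_of_nonneg (add_nonneg ha0 hb0)]
  have hρ0 : 0 ≤ ρ := integral_nonneg fun X => sq_nonneg _
  have hR : 2 * N * ρ ≤ 4 * N * C * |s'' - s| * |D| := by
    calc 2 * N * ρ ≤ 2 * N * (2 * C * a) := mul_le_mul_of_nonneg_left hρa (by positivity)
      _ ≤ 2 * N * (2 * C * a) + 2 * N * (2 * C * b) :=
          le_add_of_nonneg_right (by positivity)
      _ = 4 * N * C * (|s'' - s| * |D|) := by rw [habs]; ring
      _ = _ := by ring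
  have hD0 : 0 ≤ |D| := abs_nonneg _
  have hθ : 0 < 1 - 4 * N * C * |s'' - s| := by linarith
  rcases le_or_gt |D| (2 * N * ρ) with hle | hlt
  · -- `|D| ≤ R ≤ 4NCδ|D|` forces `D = 0`
    have hDz : |D| = 0 := by nlinarith
    rw [hDz, zero_mul]; positivity
  · -- `(|D| - R)² ≤ 4K min(a,b) ≤ 2K(a + b) = 2Kδ|D|`
    have hsa : (|D| - 2 * N * ρ) ^ 2 ≤ 4 * (K * a) := by
      have h := Real.sq_sqrt (mul_nonneg hK ha0)
      nlinarith [Real.sqrt_nonneg (K * a)]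
    have hsb : (|D| - 2 * N * ρ) ^ 2 ≤ 4 * (K * b) := by
      have h := Real.sq_sqrt (mul_nonneg hK hb0)
      nlinarith [Real.sqrt_nonneg (K * b)]
    have hs : (|D| - 2 * N * ρ) ^ 2 ≤ 2 * K * (|s'' - s| * |D|) := by rw [habs]; nlinarith
    have hlow : |D| * (1 - 4 * N * C * |s'' - s|) ≤ |D| - 2 * N * ρ := by nlinarith
    have hlow0 : 0 ≤ |D| * (1 - 4 * N * C * |s'' - s|) := by positivity
    have hsq : (|D| * (1 - 4 * N * C * |s'' - s|)) ^ 2 ≤ 2 * K * (|s'' - s| * |D|) :=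
      (pow_le_pow_left₀ hlow0 hlow 2).trans hs
    have hDpos : 0 < |D| := lt_of_le_of_lt (by positivity) hlt
    have : |D| * (|D| * (1 - 4 * N * C * |s'' - s|) ^ 2) ≤ |D| * (2 * K * |s'' - s|) := by
      nlinarith
    exact le_of_mul_le_mul_left this hDpos

end TwoPoint

/-- **Registered form (sub-goal `stub_modulationTwoPoint` of stub S3).** The sharp two-point
susceptibility inequality for a pair of positive minimisers, as a closed statement
(`abs_cosMean_sub_mul_sq_le`). [cite: Kato1966, VII §3] -/
theorem stub_modulationTwoPoint :
    ∀ (w : ℝ → ℝ≥0∞), Measurable w → ∀ (N : ℕ) (L : ℝ), 0 < L → ∀ (k : Fin 3 → ℤ)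
      (s s'' K C : ℝ), 0 ≤ K → 0 ≤ C → ∀ (Φ Ψ : PeriodicTrialState N L),
      (∀ X, Φ.ψ X = (‖Φ.ψ X‖ : ℂ)) → (∀ X, Φ.ψ X ≠ 0) → periodicEnergy w Φ ≠ ⊤ →
      (∀ Ψ' : PeriodicTrialState N L, periodicEnergy w Ψ' ≠ ⊤ →
        (periodicEnergy w Φ).toReal + s * cosMean L k Φ ≤
          (periodicEnergy w Ψ').toReal + s * cosMean L k Ψ') →
      hMinusOneSqW L (fun X => ‖Φ.ψ X‖)
          (fun X => (∑ j, Real.cos (2 * Real.pi / L * ∑ i, (k i : ℝ) * X j i)) - cosMean L k Φ)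
        ≤ ENNReal.ofReal K →
      (∀ φ : Config N → ℝ, IsPeriodicTest L φ →
        (∫ X in cellN N L, φ X ^ 2 * ‖Φ.ψ X‖ ^ 2) - (∫ X in cellN N L, φ X * ‖Φ.ψ X‖ ^ 2) ^ 2 ≤
          C * dirichletFormW L (fun X => ‖Φ.ψ X‖) φ φ) →
      (∀ X, Ψ.ψ X = (‖Ψ.ψ X‖ : ℂ)) → (∀ X, Ψ.ψ X ≠ 0) → periodicEnergy w Ψ ≠ ⊤ →
      (∀ Ψ' : PeriodicTrialState N L, periodicEnergy w Ψ' ≠ ⊤ →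
        (periodicEnergy w Ψ).toReal + s'' * cosMean L k Ψ ≤
          (periodicEnergy w Ψ').toReal + s'' * cosMean L k Ψ') →
      hMinusOneSqW L (fun X => ‖Ψ.ψ X‖)
          (fun X => (∑ j, Real.cos (2 * Real.pi / L * ∑ i, (k i : ℝ) * X j i)) - cosMean L k Ψ)
        ≤ ENNReal.ofReal K →
      4 * N * C * |s'' - s| < 1 →
      |cosMean L k Φ - cosMean L k Ψ| * (1 - 4 * N * C * |s'' - s|) ^ 2 ≤ 2 * K * |s'' - s| :=
  fun _w hw _N _L hL k _s _s'' _K _C hK hC _Φ _Ψ hreal hpos hfin hmin hχ hP hrealΨ hposΨ hfinΨ hminΨ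
      hχΨ hδ =>
    abs_cosMean_sub_mul_sq_le hL hw k hK hC hreal hpos hfin hmin hχ hP hrealΨ hposΨ hfinΨ hminΨ hχΨ hδ

end Summit.AtomisticToContinuum.BoseEinsteinCondensation.Cruxes.StaticResponseBound.UvThomsonForceWave

end
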